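import Literature.MathematicalPhysics.QuantumFieldTheory.Balaban1983to89.T3MinimiserStabilityReduction
import Literature.MathematicalPhysics.QuantumFieldTheory.Balaban1983to89.T3PrintedRegularMinimiser
import Literature.MathematicalPhysics.QuantumFieldTheory.Balaban1983to89.T3OrbitAverage
import Literature.MathematicalPhysics.QuantumFieldTheory.Balaban1983to89.B12ContinuousTransportInvariance
import Literature.MathematicalPhysics.QuantumFieldTheory.Balaban1983to89.Node00.CanonicalTransportOfRecord
import Summits.QuantumFields.YangMills.Theorems.FluctuationComparisonRegPrIntLWreg
import HarnessLib

/-!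
# Route `UnitScaleTilt` — crux `FluctuationComparisonRegPrIntL` (stmt-QuantumFields-20520), organ S2β: THE GRADIENT-SPLIT KNIT OF LINES g24-1 ∕ g24-2 AS IMPORTABLE
# THEOREMS — P∘ (positivity of the small-history density on every interior window) PROVED from ✓WREG, the junctions OSC¹∘ → GRAD¹∘, GRAD¹∘ → TAILSUP∘ → GRAD∘,
# GRAD∘ → CRUDELOC → S2β (row TEXTS inline, no schema), and the pure real-analysis «super-polynomial size × polynomial-modulus decay» interpolation

TYPED by ideator `ym-r3-idea-1` g24 in the crux workfiles `Cruxes/FluctuationComparisonRegPrIntL/Lines/gradient_split.lean` (LINE g24-1, 88df3c0a) and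
`Lines/gradient_resolved.lean` v2 (LINE g24-2, 8264344b) — NOT importable, NOT registered (RULING №36 (3)); LIFTED into this def-free Theorems file by width seat
`ym3-torus-px20` g12 on the ideator's 10:35:19Z support-need word: every theorem below is the ideator's, PROOF BLOCKS BYTE-IDENTICAL, with the organ rows that the Lines
files keep as `def … : Prop` (S2β `FluctuationPartSmall` = the registry crux_decl's text, CRUDELOC `CrudeLocalityCan`, GRAD∘ `OneBondOscillationCan`, GRAD₁∘, GRAD¹∘
`SmallHistoryOneBondIntCan`, GRAD¹₁∘, P∘ `SmallHistoryPositiveIntCan`, OSC¹∘ `SmallHistoryOscillationIntCan`, TAILSUP∘ `WindowOddsSupIntCan`) written INLINE as hypothesis ∕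
conclusion TEXTS (their `def` bodies verbatim — door-fit by script; no hypothesis schema is declared here, WORD 96), and the canonical density `heightDensityCan` taken from
✓`FluctuationComparisonRegPrIntLWregGlue` (same definition as the Lines files' local copy).

WHAT THIS FILE PROVES (nothing of Bałaban's analysis; junctions, one positivity fact from ✓WREG, and real analysis):
* from g24-1: `oneBondOscillationDepthOne_of` (GRAD∘ → GRAD₁∘), `abs_fourDiff_le_of_oneBond` (the window 4-point is two one-bond differences: `|Δ²f| ≤ 2σ`),
  `min_le_sqrt_mul`, `sqrt_exp_neg`, ★`fluctuationPartSmall_of_gradient_split : ⟨GRAD∘⟩ → ⟨CRUDELOC⟩ → ⟨S2β⟩` (the interpolation knit `min(2σ_J, C_J e^{−κ₀d}) ≤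
  √(2σ_JC_J)·e^{−κ₀d∕2}`, `J·√(2σ_JC_J) → 0` — super-polynomial size × polynomial modulus), `crudeLocality_of_fluctuationPartSmall : ⟨S2β⟩ → ⟨CRUDELOC⟩`;
* from g24-2 v2: `smallHistoryOneBondDepthOne_of`, `θBal_const_mul'`, `θBal_nonneg'`, `plaqSmall_of_interior`, ★`smallHistoryPositiveInt : ⟨P∘⟩` (PROVED from
  ✓`FluctuationComparisonRegPrIntLWreg.windowRegularity`), `smallHistoryOneBond_of_pos_osc`, ★`smallHistoryOneBond_of_osc : ⟨OSC¹∘⟩ → ⟨GRAD¹∘⟩`, `abs_sub_le_of_mem_Icc`,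
  ★`oneBondOscillation_of_resolved : ⟨GRAD¹∘⟩ → ⟨TAILSUP∘⟩ → ⟨GRAD∘⟩`.
NET (the ideator's census, unchanged): S2β ⟸ {OSC¹∘, TAILSUP∘, CRUDELOC}; this file makes the three arrows importable BY NAME.
HONEST: nothing of OSC¹∘ ∕ TAILSUP∘ ∕ GRAD∘ ∕ CRUDELOC ∕ S2β ∕ crux 20520 ∕ `YM3TorusSU2` is proved here (P∘ and the junctions are); rung R3 = SU(2) YM₃ on T³ — NOT d = 4,
NOT infinite volume, NOT a mass gap, NOT Clay.

References: [Balaban1985UV3] CMP 102 (1985) 255–275 ((41) p.266, (45)–(47) p.267); [Balaban1987RG1] CMP 109 (1987) 249–301 (Thm 1 (0.19)–(0.26));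
[Balaban1985Variational] CMP 102 (1985) 277–309 (Thm 1 (8)–(10) p.279); [Balaban1985Averaging] CMP 98 (1985) 17–51 ((10) p.19).
-/

noncomputable section

set_option autoImplicit false

open MeasureTheory Filter Topology Set
open Literature.MathematicalPhysics.QuantumFieldTheory.Balaban1983to89
open Literature.MathematicalPhysics.QuantumFieldTheory.Balaban1983to89.T3ContinuumYM3Torus
open Literature.MathematicalPhysics.QuantumFieldTheory.Balaban1983to89.T3NestedUnitLaws
open Literature.MathematicalPhysics.QuantumFieldTheory.Balaban1983to89.T3UnitLawDensityEML
open Literature.MathematicalPhysics.QuantumFieldTheory.Balaban1983to89.T3UnitScaleTilt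
open Literature.MathematicalPhysics.QuantumFieldTheory.Balaban1983to89.T3TiltDescent
open Literature.MathematicalPhysics.QuantumFieldTheory.Balaban1983to89.T3PrintedRegularMinimiser
open Literature.MathematicalPhysics.QuantumFieldTheory.Balaban1983to89.T3ConstrainedMinimiser (fibre)
open Literature.MathematicalPhysics.QuantumFieldTheory.Balaban1983to89.T3LevelShift
open Literature.MathematicalPhysics.QuantumFieldTheory.Balaban1983to89.Missing
open Literature.MathematicalPhysics.QuantumFieldTheory.Balaban1983to89.T4Continuum
open Summit.QuantumFields.YangMills.Theorems.FluctuationComparisonRegPrIntLWregGlue (heightDensityCan)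

namespace Summit.QuantumFields.YangMills.Theorems.FluctuationComparisonRegPrIntLGradientResolvedKnit

/-! ## LINE g24-2 v2 «gradient_resolved»: P∘ from ✓WREG, OSC¹∘ → GRAD¹∘, GRAD¹∘ → TAILSUP∘ → GRAD∘ -/

/-- GRAD¹∘ ⇒ GRAD¹₁∘ (specialisation to `K = J + 1`). -/
theorem smallHistoryOneBondDepthOne_of (h : (∀ (L : ℕ), ∃ c₀ : ℝ, 0 < c₀ ∧ c₀ ≤ 1 ∧ ∀ (c : ℝ), 0 < c → c ≤ c₀ → ∃ pS : ℝ, ∀ (b₀ p₀ : ℝ), 0 < b₀ → pS ≤ p₀ → 0 < p₀ →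
    ∃ ε₁ : ℝ, 0 < ε₁ ∧ ∀ (ε₀ : ℝ), 0 < ε₀ → ε₀ ≤ ε₁ →
    ∃ γ₁ : ℝ, 0 < γ₁ ∧ ∀ (F : T3Family) (γ : ℝ), F.L = L → 0 < γ → γ ≤ γ₁ →
      ∃ σ₁ : ℕ → ℝ, (∀ J, 0 ≤ σ₁ J) ∧ (∀ a : ℕ, Tendsto (fun J : ℕ => ((J : ℝ) + 1) ^ a * σ₁ J) atTop (𝓝 0)) ∧
        ∀ (J K : ℕ) (hJK : J ≤ K),
          (∀ U : GaugeField (F.P J) 0 (Matrix.specialUnitaryGroup (Fin 2) ℂ), PlaqSmall (θBal F.L γ (c * b₀) p₀ J) U →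
              0 < heightDensityCan F γ hJK (histGood F ℰp (θBal F.L γ b₀ p₀) K J) U) ∧
          ∀ (b : PBond (F.P J) 0) (U V : GaugeField (F.P J) 0 (Matrix.specialUnitaryGroup (Fin 2) ℂ)),
            PlaqSmall (θBal F.L γ (c * b₀) p₀ J) U → PlaqSmall (θBal F.L γ (c * b₀) p₀ J) V →
            (∀ e, e ≠ b → U e = V e) →
            |(Real.log (heightDensityCan F γ hJK (histGood F ℰp (θBal F.L γ b₀ p₀) K J) U)
                + (F.scheme ℰp γ).β K * minActionRegPr F J K hJK ε₀ U)
              - (Real.log (heightDensityCan F γ hJK (histGood F ℰp (θBal F.L γ b₀ p₀) K J) V)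
                + (F.scheme ℰp γ).β K * minActionRegPr F J K hJK ε₀ V)| ≤ σ₁ J)) : (∀ (L : ℕ), ∃ c₀ : ℝ, 0 < c₀ ∧ c₀ ≤ 1 ∧ ∀ (c : ℝ), 0 < c → c ≤ c₀ → ∃ pS : ℝ, ∀ (b₀ p₀ : ℝ), 0 < b₀ → pS ≤ p₀ → 0 < p₀ →
    ∃ ε₁ : ℝ, 0 < ε₁ ∧ ∀ (ε₀ : ℝ), 0 < ε₀ → ε₀ ≤ ε₁ →
    ∃ γ₁ : ℝ, 0 < γ₁ ∧ ∀ (F : T3Family) (γ : ℝ), F.L = L → 0 < γ → γ ≤ γ₁ →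
      ∃ σ₁ : ℕ → ℝ, (∀ J, 0 ≤ σ₁ J) ∧ (∀ a : ℕ, Tendsto (fun J : ℕ => ((J : ℝ) + 1) ^ a * σ₁ J) atTop (𝓝 0)) ∧
        ∀ (J : ℕ) (hJK : J ≤ J + 1),
          (∀ U : GaugeField (F.P J) 0 (Matrix.specialUnitaryGroup (Fin 2) ℂ), PlaqSmall (θBal F.L γ (c * b₀) p₀ J) U →
              0 < heightDensityCan F γ hJK (histGood F ℰp (θBal F.L γ b₀ p₀) (J + 1) J) U) ∧
          ∀ (b : PBond (F.P J) 0) (U V : GaugeField (F.P J) 0 (Matrix.specialUnitaryGroup (Fin 2) ℂ)),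
            PlaqSmall (θBal F.L γ (c * b₀) p₀ J) U → PlaqSmall (θBal F.L γ (c * b₀) p₀ J) V →
            (∀ e, e ≠ b → U e = V e) →
            |(Real.log (heightDensityCan F γ hJK (histGood F ℰp (θBal F.L γ b₀ p₀) (J + 1) J) U)
                + (F.scheme ℰp γ).β (J + 1) * minActionRegPr F J (J + 1) hJK ε₀ U)
              - (Real.log (heightDensityCan F γ hJK (histGood F ℰp (θBal F.L γ b₀ p₀) (J + 1) J) V)
                + (F.scheme ℰp γ).β (J + 1) * minActionRegPr F J (J + 1) hJK ε₀ V)| ≤ σ₁ J) := by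
  intro L
  obtain ⟨c₀, hc₀, hc₀1, H⟩ := h L
  refine ⟨c₀, hc₀, hc₀1, fun c hc hcle => ?_⟩
  obtain ⟨pS, H⟩ := H c hc hcle
  refine ⟨pS, fun b₀ p₀ hb hpS hp => ?_⟩
  obtain ⟨ε₁, hε₁, H⟩ := H b₀ p₀ hb hpS hp
  refine ⟨ε₁, hε₁, fun ε₀ hε₀ hε₀1 => ?_⟩
  obtain ⟨γ₁, hγ₁, H⟩ := H ε₀ hε₀ hε₀1
  refine ⟨γ₁, hγ₁, fun F γ hFL hγ hγle => ?_⟩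
  obtain ⟨σ₁, hσ0, hσt, H⟩ := H F γ hFL hγ hγle
  exact ⟨σ₁, hσ0, hσt, fun J hJK => H J (J + 1) hJK⟩

/-- Bałaban's thresholds are linear in the profile constant: `θ_{c·b₀}(i) = c·θ_{b₀}(i)`. [cite: Balaban1985UV3, (7) p.257] -/
theorem θBal_const_mul' (L : ℕ) (γ c b₀ p₀ : ℝ) (i : ℕ) : θBal L γ (c * b₀) p₀ i = c * θBal L γ b₀ p₀ i := by
  unfold θBal B10.pFun; ring

/-- `θBal ≥ 0` for `γ ≤ 1`, `0 ≤ b₀` (any `L : ℕ`; `√` of a negative number is `0`). [cite: Balaban1985UV3, (7) p.257] -/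
theorem θBal_nonneg' (L : ℕ) {γ b₀ : ℝ} (p₀ : ℝ) (hγ1 : γ ≤ 1) (hb : 0 ≤ b₀) (i : ℕ) : 0 ≤ θBal L γ b₀ p₀ i := by
  unfold θBal B10.pFun
  have hL0 : (0 : ℝ) ≤ ((L : ℝ)⁻¹) := inv_nonneg.mpr (Nat.cast_nonneg L)
  have hx1 : γ * ((L : ℝ)⁻¹) ^ i ≤ 1 :=
    calc γ * ((L : ℝ)⁻¹) ^ i ≤ 1 * 1 := mul_le_mul hγ1 (pow_le_one₀ hL0 (Nat.cast_inv_le_one L)) (pow_nonneg hL0 i) zero_le_one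
      _ = 1 := one_mul 1
  have hg1 : Real.sqrt (γ * ((L : ℝ)⁻¹) ^ i) ≤ 1 := (Real.sqrt_le_sqrt hx1).trans_eq Real.sqrt_one
  have hlog : 0 ≤ Real.log (Real.sqrt (γ * ((L : ℝ)⁻¹) ^ i))⁻¹ := by
    rcases (Real.sqrt_nonneg (γ * ((L : ℝ)⁻¹) ^ i)).eq_or_lt with h | h
    · rw [← h]; simp
    · exact Real.log_nonneg ((one_le_inv_iff₀).mpr ⟨h, hg1⟩)
  exact mul_nonneg (Real.sqrt_nonneg _) (mul_nonneg hb (Real.rpow_nonneg (by linarith) _))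

/-- The interior window lies inside the `b₀`-window (`c ≤ 1`). -/
theorem plaqSmall_of_interior {F : T3Family} {γ b₀ p₀ c : ℝ} (hγ1 : γ ≤ 1) (hb : 0 ≤ b₀) (hc1 : c ≤ 1) (J : ℕ)
    {U : GaugeField (F.P J) 0 (Matrix.specialUnitaryGroup (Fin 2) ℂ)} (hU : PlaqSmall (θBal F.L γ (c * b₀) p₀ J) U) :
    PlaqSmall (θBal F.L γ b₀ p₀ J) U :=
  fun p => (hU p).trans_le (by rw [θBal_const_mul']; exact mul_le_of_le_one_left (θBal_nonneg' F.L p₀ hγ1 hb J) hc1)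

/-- ★ P∘ PROVED from ✓WREG (`γ₁ := min γ₁^{WREG} 1`, density coupling `γ' := γ`). -/
theorem smallHistoryPositiveInt : (∀ (L : ℕ) (b₀ p₀ : ℝ), 0 < b₀ → 0 < p₀ → ∃ γ₁ : ℝ, 0 < γ₁ ∧ ∀ (F : T3Family) (γ : ℝ), F.L = L → 0 < γ → γ ≤ γ₁ →
    ∀ (c : ℝ), 0 < c → c ≤ 1 → ∀ (J K : ℕ) (hJK : J ≤ K) (U : GaugeField (F.P J) 0 (Matrix.specialUnitaryGroup (Fin 2) ℂ)),
      PlaqSmall (θBal F.L γ (c * b₀) p₀ J) U → 0 < heightDensityCan F γ hJK (histGood F ℰp (θBal F.L γ b₀ p₀) K J) U) := by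
  intro L b₀ p₀ hb₀ hp₀
  obtain ⟨γW, hγW, HW⟩ :=
    Summit.QuantumFields.YangMills.Theorems.FluctuationComparisonRegPrIntLWreg.windowRegularity L b₀ p₀ hb₀ hp₀
  refine ⟨min γW 1, lt_min hγW one_pos, ?_⟩
  intro F γ hFL hγ hγ1 c hc hc1 J K hJK U hU
  have hU' : PlaqSmall (θBal F.L γ b₀ p₀ J) U := plaqSmall_of_interior (hγ1.trans (min_le_right _ _)) hb₀.le hc1 J hU
  exact (HW F γ hFL hγ (hγ1.trans (min_le_left _ _)) J K hJK γ hγ).2 U hU'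

/-- ✓ P∘ → OSC¹∘ → GRAD¹∘ (`γ₁ := min`, `c ≤ c₀ ≤ 1`). -/
theorem smallHistoryOneBond_of_pos_osc (hP : (∀ (L : ℕ) (b₀ p₀ : ℝ), 0 < b₀ → 0 < p₀ → ∃ γ₁ : ℝ, 0 < γ₁ ∧ ∀ (F : T3Family) (γ : ℝ), F.L = L → 0 < γ → γ ≤ γ₁ →
    ∀ (c : ℝ), 0 < c → c ≤ 1 → ∀ (J K : ℕ) (hJK : J ≤ K) (U : GaugeField (F.P J) 0 (Matrix.specialUnitaryGroup (Fin 2) ℂ)),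
      PlaqSmall (θBal F.L γ (c * b₀) p₀ J) U → 0 < heightDensityCan F γ hJK (histGood F ℰp (θBal F.L γ b₀ p₀) K J) U)) (hO : (∀ (L : ℕ), ∃ c₀ : ℝ, 0 < c₀ ∧ c₀ ≤ 1 ∧ ∀ (c : ℝ), 0 < c → c ≤ c₀ → ∃ pS : ℝ, ∀ (b₀ p₀ : ℝ), 0 < b₀ → pS ≤ p₀ → 0 < p₀ →
    ∃ ε₁ : ℝ, 0 < ε₁ ∧ ∀ (ε₀ : ℝ), 0 < ε₀ → ε₀ ≤ ε₁ →
    ∃ γ₁ : ℝ, 0 < γ₁ ∧ ∀ (F : T3Family) (γ : ℝ), F.L = L → 0 < γ → γ ≤ γ₁ →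
      ∃ σ₁ : ℕ → ℝ, (∀ J, 0 ≤ σ₁ J) ∧ (∀ a : ℕ, Tendsto (fun J : ℕ => ((J : ℝ) + 1) ^ a * σ₁ J) atTop (𝓝 0)) ∧
        ∀ (J K : ℕ) (hJK : J ≤ K) (b : PBond (F.P J) 0) (U V : GaugeField (F.P J) 0 (Matrix.specialUnitaryGroup (Fin 2) ℂ)),
            PlaqSmall (θBal F.L γ (c * b₀) p₀ J) U → PlaqSmall (θBal F.L γ (c * b₀) p₀ J) V →
            (∀ e, e ≠ b → U e = V e) →
            |(Real.log (heightDensityCan F γ hJK (histGood F ℰp (θBal F.L γ b₀ p₀) K J) U)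
                + (F.scheme ℰp γ).β K * minActionRegPr F J K hJK ε₀ U)
              - (Real.log (heightDensityCan F γ hJK (histGood F ℰp (θBal F.L γ b₀ p₀) K J) V)
                + (F.scheme ℰp γ).β K * minActionRegPr F J K hJK ε₀ V)| ≤ σ₁ J)) :
    (∀ (L : ℕ), ∃ c₀ : ℝ, 0 < c₀ ∧ c₀ ≤ 1 ∧ ∀ (c : ℝ), 0 < c → c ≤ c₀ → ∃ pS : ℝ, ∀ (b₀ p₀ : ℝ), 0 < b₀ → pS ≤ p₀ → 0 < p₀ →
    ∃ ε₁ : ℝ, 0 < ε₁ ∧ ∀ (ε₀ : ℝ), 0 < ε₀ → ε₀ ≤ ε₁ →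
    ∃ γ₁ : ℝ, 0 < γ₁ ∧ ∀ (F : T3Family) (γ : ℝ), F.L = L → 0 < γ → γ ≤ γ₁ →
      ∃ σ₁ : ℕ → ℝ, (∀ J, 0 ≤ σ₁ J) ∧ (∀ a : ℕ, Tendsto (fun J : ℕ => ((J : ℝ) + 1) ^ a * σ₁ J) atTop (𝓝 0)) ∧
        ∀ (J K : ℕ) (hJK : J ≤ K),
          (∀ U : GaugeField (F.P J) 0 (Matrix.specialUnitaryGroup (Fin 2) ℂ), PlaqSmall (θBal F.L γ (c * b₀) p₀ J) U →
              0 < heightDensityCan F γ hJK (histGood F ℰp (θBal F.L γ b₀ p₀) K J) U) ∧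
          ∀ (b : PBond (F.P J) 0) (U V : GaugeField (F.P J) 0 (Matrix.specialUnitaryGroup (Fin 2) ℂ)),
            PlaqSmall (θBal F.L γ (c * b₀) p₀ J) U → PlaqSmall (θBal F.L γ (c * b₀) p₀ J) V →
            (∀ e, e ≠ b → U e = V e) →
            |(Real.log (heightDensityCan F γ hJK (histGood F ℰp (θBal F.L γ b₀ p₀) K J) U)
                + (F.scheme ℰp γ).β K * minActionRegPr F J K hJK ε₀ U)
              - (Real.log (heightDensityCan F γ hJK (histGood F ℰp (θBal F.L γ b₀ p₀) K J) V)
                + (F.scheme ℰp γ).β K * minActionRegPr F J K hJK ε₀ V)| ≤ σ₁ J) := by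
  intro L
  obtain ⟨c₀, hc₀, hc₀1, HO⟩ := hO L
  refine ⟨c₀, hc₀, hc₀1, ?_⟩
  intro c hc hcc₀
  obtain ⟨pS, HpS⟩ := HO c hc hcc₀
  refine ⟨pS, ?_⟩
  intro b₀ p₀ hb₀ hpS hp₀
  obtain ⟨ε₁, hε₁, Hε⟩ := HpS b₀ p₀ hb₀ hpS hp₀
  refine ⟨ε₁, hε₁, ?_⟩
  intro ε₀ hε₀ hε₀1
  obtain ⟨γO, hγO, HγO⟩ := Hε ε₀ hε₀ hε₀1
  obtain ⟨γP, hγP, HγP⟩ := hP L b₀ p₀ hb₀ hp₀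
  refine ⟨min γO γP, lt_min hγO hγP, ?_⟩
  intro F γ hFL hγ hγ1
  obtain ⟨σ₁, hσ0, hσT, Hσ⟩ := HγO F γ hFL hγ (hγ1.trans (min_le_left _ _))
  refine ⟨σ₁, hσ0, hσT, ?_⟩
  intro J K hJK
  exact ⟨fun U hU => HγP F γ hFL hγ (hγ1.trans (min_le_right _ _)) c hc (hcc₀.trans hc₀1) J K hJK U hU,
    fun b U V hU hV hUV => Hσ J K hJK b U V hU hV hUV⟩

/-- ★ OSC¹∘ → GRAD¹∘ (P∘ supplied by ✓`smallHistoryPositiveInt`). -/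
theorem smallHistoryOneBond_of_osc (hO : (∀ (L : ℕ), ∃ c₀ : ℝ, 0 < c₀ ∧ c₀ ≤ 1 ∧ ∀ (c : ℝ), 0 < c → c ≤ c₀ → ∃ pS : ℝ, ∀ (b₀ p₀ : ℝ), 0 < b₀ → pS ≤ p₀ → 0 < p₀ →
    ∃ ε₁ : ℝ, 0 < ε₁ ∧ ∀ (ε₀ : ℝ), 0 < ε₀ → ε₀ ≤ ε₁ →
    ∃ γ₁ : ℝ, 0 < γ₁ ∧ ∀ (F : T3Family) (γ : ℝ), F.L = L → 0 < γ → γ ≤ γ₁ →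
      ∃ σ₁ : ℕ → ℝ, (∀ J, 0 ≤ σ₁ J) ∧ (∀ a : ℕ, Tendsto (fun J : ℕ => ((J : ℝ) + 1) ^ a * σ₁ J) atTop (𝓝 0)) ∧
        ∀ (J K : ℕ) (hJK : J ≤ K) (b : PBond (F.P J) 0) (U V : GaugeField (F.P J) 0 (Matrix.specialUnitaryGroup (Fin 2) ℂ)),
            PlaqSmall (θBal F.L γ (c * b₀) p₀ J) U → PlaqSmall (θBal F.L γ (c * b₀) p₀ J) V →
            (∀ e, e ≠ b → U e = V e) →
            |(Real.log (heightDensityCan F γ hJK (histGood F ℰp (θBal F.L γ b₀ p₀) K J) U)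
                + (F.scheme ℰp γ).β K * minActionRegPr F J K hJK ε₀ U)
              - (Real.log (heightDensityCan F γ hJK (histGood F ℰp (θBal F.L γ b₀ p₀) K J) V)
                + (F.scheme ℰp γ).β K * minActionRegPr F J K hJK ε₀ V)| ≤ σ₁ J)) : (∀ (L : ℕ), ∃ c₀ : ℝ, 0 < c₀ ∧ c₀ ≤ 1 ∧ ∀ (c : ℝ), 0 < c → c ≤ c₀ → ∃ pS : ℝ, ∀ (b₀ p₀ : ℝ), 0 < b₀ → pS ≤ p₀ → 0 < p₀ →
    ∃ ε₁ : ℝ, 0 < ε₁ ∧ ∀ (ε₀ : ℝ), 0 < ε₀ → ε₀ ≤ ε₁ →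
    ∃ γ₁ : ℝ, 0 < γ₁ ∧ ∀ (F : T3Family) (γ : ℝ), F.L = L → 0 < γ → γ ≤ γ₁ →
      ∃ σ₁ : ℕ → ℝ, (∀ J, 0 ≤ σ₁ J) ∧ (∀ a : ℕ, Tendsto (fun J : ℕ => ((J : ℝ) + 1) ^ a * σ₁ J) atTop (𝓝 0)) ∧
        ∀ (J K : ℕ) (hJK : J ≤ K),
          (∀ U : GaugeField (F.P J) 0 (Matrix.specialUnitaryGroup (Fin 2) ℂ), PlaqSmall (θBal F.L γ (c * b₀) p₀ J) U →
              0 < heightDensityCan F γ hJK (histGood F ℰp (θBal F.L γ b₀ p₀) K J) U) ∧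
          ∀ (b : PBond (F.P J) 0) (U V : GaugeField (F.P J) 0 (Matrix.specialUnitaryGroup (Fin 2) ℂ)),
            PlaqSmall (θBal F.L γ (c * b₀) p₀ J) U → PlaqSmall (θBal F.L γ (c * b₀) p₀ J) V →
            (∀ e, e ≠ b → U e = V e) →
            |(Real.log (heightDensityCan F γ hJK (histGood F ℰp (θBal F.L γ b₀ p₀) K J) U)
                + (F.scheme ℰp γ).β K * minActionRegPr F J K hJK ε₀ U)
              - (Real.log (heightDensityCan F γ hJK (histGood F ℰp (θBal F.L γ b₀ p₀) K J) V)
                + (F.scheme ℰp γ).β K * minActionRegPr F J K hJK ε₀ V)| ≤ σ₁ J) :=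
  smallHistoryOneBond_of_pos_osc smallHistoryPositiveInt hO

/-- A difference of two numbers in `[0, t]` has absolute value `≤ t`. -/
theorem abs_sub_le_of_mem_Icc {x y t : ℝ} (hx0 : 0 ≤ x) (hxt : x ≤ t) (hy0 : 0 ≤ y) (hyt : y ≤ t) : |x - y| ≤ t := by
  rw [abs_le]; constructor <;> linarith

/-- **COMPOSITION · GRAD¹∘ → TAILSUP∘ → GRAD∘ (PROVED)**: common window fraction `c := min c₁ c₂`; both rows read at history profile `b₀ ∕ c`, whose interior
window `c · (b₀ ∕ c) = b₀` IS GRAD∘'s window; then `f U − f V = [f¹ U − f¹ V] + [(log ρ U − a₀ − log g U) − (log ρ V − a₀ − log g V)]`, the first bracket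
`≤ σ₁ J` (GRAD¹∘), the second a difference of two numbers in `[0, τ J]` (TAILSUP∘, fed GRAD¹∘'s positivity clause), so `σ := σ₁ + τ` (super-polynomial) serves.
[cite: Balaban1985UV3, (41) p.266; Balaban1989LargeFieldII, (1.77)-(1.79) p.383] -/
theorem oneBondOscillation_of_resolved : ((∀ (L : ℕ), ∃ c₀ : ℝ, 0 < c₀ ∧ c₀ ≤ 1 ∧ ∀ (c : ℝ), 0 < c → c ≤ c₀ → ∃ pS : ℝ, ∀ (b₀ p₀ : ℝ), 0 < b₀ → pS ≤ p₀ → 0 < p₀ →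
    ∃ ε₁ : ℝ, 0 < ε₁ ∧ ∀ (ε₀ : ℝ), 0 < ε₀ → ε₀ ≤ ε₁ →
    ∃ γ₁ : ℝ, 0 < γ₁ ∧ ∀ (F : T3Family) (γ : ℝ), F.L = L → 0 < γ → γ ≤ γ₁ →
      ∃ σ₁ : ℕ → ℝ, (∀ J, 0 ≤ σ₁ J) ∧ (∀ a : ℕ, Tendsto (fun J : ℕ => ((J : ℝ) + 1) ^ a * σ₁ J) atTop (𝓝 0)) ∧
        ∀ (J K : ℕ) (hJK : J ≤ K),
          (∀ U : GaugeField (F.P J) 0 (Matrix.specialUnitaryGroup (Fin 2) ℂ), PlaqSmall (θBal F.L γ (c * b₀) p₀ J) U →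
              0 < heightDensityCan F γ hJK (histGood F ℰp (θBal F.L γ b₀ p₀) K J) U) ∧
          ∀ (b : PBond (F.P J) 0) (U V : GaugeField (F.P J) 0 (Matrix.specialUnitaryGroup (Fin 2) ℂ)),
            PlaqSmall (θBal F.L γ (c * b₀) p₀ J) U → PlaqSmall (θBal F.L γ (c * b₀) p₀ J) V →
            (∀ e, e ≠ b → U e = V e) →
            |(Real.log (heightDensityCan F γ hJK (histGood F ℰp (θBal F.L γ b₀ p₀) K J) U)
                + (F.scheme ℰp γ).β K * minActionRegPr F J K hJK ε₀ U)
              - (Real.log (heightDensityCan F γ hJK (histGood F ℰp (θBal F.L γ b₀ p₀) K J) V)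
                + (F.scheme ℰp γ).β K * minActionRegPr F J K hJK ε₀ V)| ≤ σ₁ J) → (∀ (L : ℕ), ∃ c₀ : ℝ, 0 < c₀ ∧ c₀ ≤ 1 ∧ ∀ (c : ℝ), 0 < c → c ≤ c₀ → ∃ pS : ℝ, ∀ (b₀ p₀ : ℝ), 0 < b₀ → pS ≤ p₀ → 0 < p₀ →
    ∃ γ₁ : ℝ, 0 < γ₁ ∧ ∀ (F : T3Family) (γ : ℝ), F.L = L → 0 < γ → γ ≤ γ₁ →
      ∃ τ : ℕ → ℝ, (∀ J, 0 ≤ τ J) ∧ (∀ a : ℕ, Tendsto (fun J : ℕ => ((J : ℝ) + 1) ^ a * τ J) atTop (𝓝 0)) ∧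
        ∀ (ν : ℕ → (j : ℕ) → Measure (GaugeField (F.P j) 0 (Matrix.specialUnitaryGroup (Fin 2) ℂ))),
          (∀ K, ν K K = T4GenFunBounds.gibbsMeasure (F.P K) ((F.scheme ℰp γ).β K)) →
          (∀ K j, j < K → ν K j = Measure.map (descend F ℰp j) (ν K (j + 1))) →
          ∀ (J K : ℕ) (hJK : J ≤ K) (ρ : GaugeField (F.P J) 0 (Matrix.specialUnitaryGroup (Fin 2) ℂ) → ℝ),
            (∀ U, PlaqSmall (θBal F.L γ (c * b₀) p₀ J) U → 0 < ρ U) →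
            ν K J = (fieldMeasure _ _ _).withDensity (fun U => ENNReal.ofReal (ρ U)) →
            ContinuousOn ρ {U | PlaqSmall (θBal F.L γ (c * b₀) p₀ J) U} →
            (∀ U : GaugeField (F.P J) 0 (Matrix.specialUnitaryGroup (Fin 2) ℂ), PlaqSmall (θBal F.L γ (c * b₀) p₀ J) U →
                0 < heightDensityCan F γ hJK (histGood F ℰp (θBal F.L γ b₀ p₀) K J) U) →
            ∃ a₀ : ℝ, ∀ U : GaugeField (F.P J) 0 (Matrix.specialUnitaryGroup (Fin 2) ℂ), PlaqSmall (θBal F.L γ (c * b₀) p₀ J) U →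
              0 ≤ Real.log (ρ U) - a₀ - Real.log (heightDensityCan F γ hJK (histGood F ℰp (θBal F.L γ b₀ p₀) K J) U) ∧
              Real.log (ρ U) - a₀ - Real.log (heightDensityCan F γ hJK (histGood F ℰp (θBal F.L γ b₀ p₀) K J) U) ≤ τ J) → (∀ (L : ℕ), ∃ pS : ℝ, ∀ (b₀ p₀ : ℝ), 0 < b₀ → pS ≤ p₀ → 0 < p₀ → ∃ ε₁ : ℝ, 0 < ε₁ ∧ ∀ (ε₀ : ℝ), 0 < ε₀ → ε₀ ≤ ε₁ →
    ∃ γ₁ : ℝ, 0 < γ₁ ∧ ∀ (F : T3Family) (γ : ℝ), F.L = L → 0 < γ → γ ≤ γ₁ →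
      ∃ (σ : ℕ → ℝ), (∀ J, 0 ≤ σ J) ∧ (∀ a : ℕ, Tendsto (fun J : ℕ => ((J : ℝ) + 1) ^ a * σ J) atTop (𝓝 0)) ∧
        ∀ (ν : ℕ → (j : ℕ) → Measure (GaugeField (F.P j) 0 (Matrix.specialUnitaryGroup (Fin 2) ℂ))),
          (∀ K, ν K K = T4GenFunBounds.gibbsMeasure (F.P K) ((F.scheme ℰp γ).β K)) →
          (∀ K j, j < K → ν K j = Measure.map (descend F ℰp j) (ν K (j + 1))) →
          ∀ (J K : ℕ) (hJK : J ≤ K) (ρ : GaugeField (F.P J) 0 (Matrix.specialUnitaryGroup (Fin 2) ℂ) → ℝ),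
            (∀ U, PlaqSmall (θBal F.L γ b₀ p₀ J) U → 0 < ρ U) →
            ν K J = (fieldMeasure _ _ _).withDensity (fun U => ENNReal.ofReal (ρ U)) →
            ContinuousOn ρ {U | PlaqSmall (θBal F.L γ b₀ p₀ J) U} →
            ∀ (b : PBond (F.P J) 0) (U V : GaugeField (F.P J) 0 (Matrix.specialUnitaryGroup (Fin 2) ℂ)),
              PlaqSmall (θBal F.L γ b₀ p₀ J) U → PlaqSmall (θBal F.L γ b₀ p₀ J) V →
              (∀ e, e ≠ b → U e = V e) →
              |(Real.log (ρ U) + (F.scheme ℰp γ).β K * minActionRegPr F J K hJK ε₀ U)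
                  - (Real.log (ρ V) + (F.scheme ℰp γ).β K * minActionRegPr F J K hJK ε₀ V)| ≤ σ J)) := by
  intro h1 h2 L
  obtain ⟨c₁, hc₁, -, H1⟩ := h1 L
  obtain ⟨c₂, hc₂, -, H2⟩ := h2 L
  -- ONE COMMON WINDOW FRACTION `c := min c₁ c₂`
  obtain ⟨c, hc, hcle₁, hcle₂⟩ : ∃ c : ℝ, 0 < c ∧ c ≤ c₁ ∧ c ≤ c₂ :=
    ⟨min c₁ c₂, lt_min hc₁ hc₂, min_le_left _ _, min_le_right _ _⟩
  obtain ⟨pS₁, H1⟩ := H1 c hc hcle₁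
  obtain ⟨pS₂, H2⟩ := H2 c hc hcle₂
  refine ⟨max pS₁ pS₂, fun b₀ p₀ hb hpS hp => ?_⟩
  -- THE `b₀ ∕ c` INSTANTIATION: interior window `c · (b₀ ∕ c) = b₀` = GRAD∘'s window; history profile `b₀ ∕ c`
  have hb' : 0 < b₀ / c := div_pos hb hc
  have e : c * (b₀ / c) = b₀ := mul_div_cancel₀ b₀ hc.ne'
  obtain ⟨ε₁, hε₁, H1⟩ := H1 (b₀ / c) p₀ hb' ((le_max_left _ _).trans hpS) hp
  obtain ⟨γ₂, hγ₂, H2⟩ := H2 (b₀ / c) p₀ hb' ((le_max_right _ _).trans hpS) hp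
  refine ⟨ε₁, hε₁, fun ε₀ hε₀ hε₀1 => ?_⟩
  obtain ⟨γ₁, hγ₁, H1⟩ := H1 ε₀ hε₀ hε₀1
  refine ⟨min γ₁ γ₂, lt_min hγ₁ hγ₂, fun F γ hFL hγ hγle => ?_⟩
  obtain ⟨σ₁, hσ0, hσt, H1⟩ := H1 F γ hFL hγ (hγle.trans (min_le_left _ _))
  obtain ⟨τ, hτ0, hτt, H2⟩ := H2 F γ hFL hγ (hγle.trans (min_le_right _ _))
  -- rewrite the rows' interior window `θBal F.L γ (c * (b₀ / c)) p₀ J` to GRAD∘'s window `θBal F.L γ b₀ p₀ J`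
  simp only [e] at H1 H2
  refine ⟨fun J => σ₁ J + τ J, fun J => add_nonneg (hσ0 J) (hτ0 J), fun a => ?_, ?_⟩
  · have h := (hσt a).add (hτt a)
    rw [add_zero] at h
    refine h.congr' (Eventually.of_forall fun J => ?_)
    ring
  · intro ν hνK hνd J K hJK ρ hρpos hνρ hρcont b U V hU hV hUV
    obtain ⟨hgpos, H1q⟩ := H1 J K hJK
    obtain ⟨a₀, H2q⟩ := H2 ν hνK hνd J K hJK ρ hρpos hνρ hρcont hgpos
    have hf1 := H1q b U V hU hV hUV
    obtain ⟨hU0, hU1⟩ := H2q U hU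
    obtain ⟨hV0, hV1⟩ := H2q V hV
    have hD := abs_sub_le_of_mem_Icc hU0 hU1 hV0 hV1
    -- `f U − f V = [f¹ U − f¹ V] + [D U − D V]`
    have key :
        (Real.log (ρ U) + (F.scheme ℰp γ).β K * minActionRegPr F J K hJK ε₀ U)
          - (Real.log (ρ V) + (F.scheme ℰp γ).β K * minActionRegPr F J K hJK ε₀ V)
        = ((Real.log (heightDensityCan F γ hJK (histGood F ℰp (θBal F.L γ (b₀ / c) p₀) K J) U)
              + (F.scheme ℰp γ).β K * minActionRegPr F J K hJK ε₀ U)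
            - (Real.log (heightDensityCan F γ hJK (histGood F ℰp (θBal F.L γ (b₀ / c) p₀) K J) V)
              + (F.scheme ℰp γ).β K * minActionRegPr F J K hJK ε₀ V))
          + ((Real.log (ρ U) - a₀ - Real.log (heightDensityCan F γ hJK (histGood F ℰp (θBal F.L γ (b₀ / c) p₀) K J) U))
            - (Real.log (ρ V) - a₀ - Real.log (heightDensityCan F γ hJK (histGood F ℰp (θBal F.L γ (b₀ / c) p₀) K J) V))) := by
      ring
    show |_| ≤ σ₁ J + τ J
    rw [key]
    exact (abs_add_le _ _).trans (add_le_add hf1 hD)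

end Summit.QuantumFields.YangMills.Theorems.FluctuationComparisonRegPrIntLGradientResolvedKnit

end
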